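import Summits.QuantumFields.YangMills.Theorems.ColdStartUniversalityLatticeLangevinRiemannContractionAllLipschitz
import Summits.QuantumFields.YangMills.Theorems.ColdStartUniversalityLatticeLangevinRiemannLipschitzFunctionalInequalities
import HarnessLib

/-!
# Poincaré inequality and Gaussian concentration for EVERY `ρ_L`-Lipschitz observable of the `SU(2)` Wilson–Gibbs measure on `(ℤ/L)³`,
# `|β'| < 1/12`, uniformly in the volume: `Var_(μ_(β'))(F) ≤ Lip_(ρ_L)(F)²/(1 − 12|β'|)`, `μ_(β'){F ≥ μF + s} ≤ exp(−(1−12|β'|)s²/(2Lip²))`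

Seat `ym-line-csu-p1` (g41), route `ColdStartUniversality` of `Summits/QuantumFields/YangMills`, helper file G56 (`--supports stmt-QuantumFields-24809`).
G46 (`…RiemannLipschitzFunctionalInequalities`) proved both inequalities for `C³` CYLINDER observables `f∘coords`; this file removes the smoothness
restriction with the mollification of G52–G54 (quaternionic-retraction extension `F̃ = χ·(F∘π)`, normed bump `φ_r`):

* ★★ `exists_smooth_riemannLipschitz_approx` — for `F` `L_F`-Lipschitz in `ρ_L` and `0 < r ≤ 1/4` there is a `C⁵` function `g` of the link coordinates
  with `|g∘coords − F| ≤ 12·L_F·√#E·r` and `Lip_(ρ_L)(g∘coords) ≤ L_F/(1 − 2r)` (the construction inside G54, factored out);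
* ★★★ `wilson_variance_le_of_riemannLipschitz_all` — `∫(F − μF)² dμ_(β') ≤ L_F²/(1 − 12|β'|)` for EVERY `ρ_L`-Lipschitz `F` (Young `(b+d)² ≤ (1+η)b²
  + (1+1/η)d²` against the approximant, then `r → 0`, `η → 0`);
* ★★★ `wilson_concentration_riemannLipschitz_all` — `μ_(β'){V | μF + s ≤ F(V)} ≤ exp(−(1−12|β'|)·s²/(2L_F²))` for every `ρ_L`-Lipschitz `F`, `L_F > 0`,
  `s ≥ 0` (`{μF + s ≤ F} ⊆ {μG + s − 2ε ≤ G}` for the approximant `G`, then `r → 0`).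

SZZ Corollary 4.4 ((4.11) Poincaré) and the Herbst consequence of (4.12), in the intrinsic Lipschitz currency, kernel-checked and uniform in `L`.
THEOREMS ONLY, no definition, no sorry.  HONEST FRAMING: fixed cut-off, high temperature `|β'| < 1/12`; nothing `K`-uniform along the route's scaling;
`UniformColdStartMixing` (24809, ASIDE) is not restated; no crux, rung or summit statement is proved; the Yang–Mills mass gap is NOT proved.
-/

set_option autoImplicit false

noncomputable section

namespace Summit.QuantumFields.YangMills.Theorems.ColdStartUniversality

open MeasureTheory ProbabilityTheory Matrix Complex Finset Filter Topology Set Metric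
open scoped ComplexConjugate BigOperators Real NNReal Convolution
open Literature.MathematicalPhysics.QuantumFieldTheory
open Literature.MathematicalPhysics.QuantumLattice (fundamentalRep fundamentalLatticeRep continuous_fundamentalRep fundamentalRep_apply fundamentalLatticeRep_N)

/-! ## §1. Smooth `ρ_L`-Lipschitz approximation of a Lipschitz observable -/

/-- ★★ **Smooth approximation with controlled `ρ_L`-Lipschitz constant.**  For `F : SU(2)^E → ℝ` with `|F(Q') − F(Q)| ≤ L_F·ρ_L(Q,Q')` and
`0 < r ≤ 1/4` there is a `C⁵` function `g` of the real link coordinates with `|g(coords P) − F(P)| ≤ 12·L_F·√#E·r` and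
`|g(coords P') − g(coords P)| ≤ (L_F/(1−2r))·ρ_L(P,P')` (mollified quaternionic-retraction extension, G52–G54). [cite: ShenZhuZhu2022, §4.1] -/
theorem exists_smooth_riemannLipschitz_approx (L : ℕ) [NeZero L]
    {F : GaugeConfig 3 L (Matrix.specialUnitaryGroup (Fin 2) ℂ) → ℝ} {Lf : ℝ} (hLf : 0 ≤ Lf)
    (hlip : ∀ Q Q', |F Q' - F Q| ≤ Lf * Real.sqrt (torusRiemannDistSq (fundamentalLatticeRep 2) Q Q')) {r : ℝ} (hr0 : 0 < r) (hr : r ≤ 1 / 4) :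
    let coords : GaugeConfig 3 L (Matrix.specialUnitaryGroup (Fin 2) ℂ) → (Edge 3 L × Fin 2 × Fin 2 × Bool → ℝ) :=
      fun V q => (fun z : ℂ => if q.2.2.2 then z.im else z.re) ((fundamentalRep (Fin 2) (V q.1) : Matrix (Fin 2) (Fin 2) ℂ) q.2.1 q.2.2.1)
    ∃ g : (Edge 3 L × Fin 2 × Fin 2 × Bool → ℝ) → ℝ, ContDiff ℝ 5 g ∧
      (∀ P : GaugeConfig 3 L (Matrix.specialUnitaryGroup (Fin 2) ℂ), |g (coords P) - F P| ≤ Lf * (12 * Real.sqrt (Fintype.card (Edge 3 L)) * r)) ∧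
      (∀ P P' : GaugeConfig 3 L (Matrix.specialUnitaryGroup (Fin 2) ℂ),
        |g (coords P') - g (coords P)| ≤ Lf / (1 - 2 * r) * Real.sqrt (torusRiemannDistSq (fundamentalLatticeRep 2) P P')) := by
  intro coords
  let rebuild : (Edge 3 L × Fin 2 × Fin 2 × Bool → ℝ) → Edge 3 L → Matrix (Fin 2) (Fin 2) ℂ :=
    fun x e => Matrix.of fun i j : Fin 2 => ((x (e, i, j, false) : ℝ) : ℂ) + ((x (e, i, j, true) : ℝ) : ℂ) * Complex.I
  let qP : Matrix (Fin 2) (Fin 2) ℂ → Matrix (Fin 2) (Fin 2) ℂ := fun M =>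
    !![(M 0 0 + conj (M 1 1)) / 2, (M 0 1 - conj (M 1 0)) / 2; -conj ((M 0 1 - conj (M 1 0)) / 2), conj ((M 0 0 + conj (M 1 1)) / 2)]
  let retr : (Edge 3 L × Fin 2 × Fin 2 × Bool → ℝ) → GaugeConfig 3 L (Matrix.specialUnitaryGroup (Fin 2) ℂ) := fun x e =>
    if h : hsForm 2 (qP (rebuild x e)) (qP (rebuild x e)) ≠ 0 then
      ⟨(Real.sqrt 2 / Real.sqrt (hsForm 2 (qP (rebuild x e)) (qP (rebuild x e)))) • qP (rebuild x e),
        normalize_quatProj_mem_specialUnitaryGroup_two (rebuild x e) h⟩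
    else 1
  let cut : (Edge 3 L × Fin 2 × Fin 2 × Bool → ℝ) → ℝ := fun x =>
    ∏ e : Edge 3 L, Real.smoothTransition (8 * hsForm 2 (qP (rebuild x e)) (qP (rebuild x e)) - 1)
  have hFc : Continuous F := continuous_of_riemannLipschitz hlip
  let Ft : (Edge 3 L × Fin 2 × Fin 2 × Bool → ℝ) → ℝ := fun x => cut x * F (retr x)
  have hFt : Continuous Ft := continuous_ext F hFc
  let φ : ContDiffBump (0 : Edge 3 L × Fin 2 × Fin 2 × Bool → ℝ) := ⟨r / 2, r, half_pos hr0, half_lt_self hr0⟩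
  let g : (Edge 3 L × Fin 2 × Fin 2 × Bool → ℝ) → ℝ := φ.normed volume ⋆[ContinuousLinearMap.lsmul ℝ ℝ, volume] Ft
  have hg : ContDiff ℝ 5 g := φ.hasCompactSupport_normed.contDiff_convolution_left _ φ.contDiff_normed hFt.locallyIntegrable
  have happrox : ∀ P : GaugeConfig 3 L (Matrix.specialUnitaryGroup (Fin 2) ℂ), |g (coords P) - F P| ≤ Lf * (12 * Real.sqrt (Fintype.card (Edge 3 L)) * r) := by
    intro P
    have hP : Ft (coords P) = F P := (ext_coords F P).2
    have h1 : dist (g (coords P)) (Ft (coords P)) ≤ Lf * (12 * Real.sqrt (Fintype.card (Edge 3 L)) * r) := by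
      refine φ.dist_normed_convolution_le hFt.aestronglyMeasurable fun x hx => ?_
      have hx' : ‖x - coords P‖ ≤ r := by
        have h := (Metric.mem_ball.1 hx).le
        rwa [dist_eq_norm] at h
      have hmod : |cut x * F (retr x) - F P| ≤ Lf * (12 * Real.sqrt (Fintype.card (Edge 3 L)) * r) := ext_modulus F hLf hlip P x hr hx'
      rw [Real.dist_eq, hP]
      exact hmod
    rw [Real.dist_eq, hP] at h1
    exact h1
  have hC : 0 ≤ Lf / (1 - 2 * r) := div_nonneg hLf (by linarith)
  have hglip : ∀ P P' : GaugeConfig 3 L (Matrix.specialUnitaryGroup (Fin 2) ℂ),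
      |g (coords P') - g (coords P)| ≤ Lf / (1 - 2 * r) * Real.sqrt (torusRiemannDistSq (fundamentalLatticeRep 2) P P') := by
    refine fun P P' => riemannLipschitz_of_local (L := L) (h := fun P => g (coords P)) hC (fun Q₀ η hη => ?_) P P'
    obtain ⟨δ, hδ, hloc⟩ : ∃ δ > 0, ∀ s : Edge 3 L × Fin 2 × Fin 2 × Bool → ℝ, ‖s‖ ≤ r →
        ∀ P P' : GaugeConfig 3 L (Matrix.specialUnitaryGroup (Fin 2) ℂ), Real.sqrt (torusRiemannDistSq (fundamentalLatticeRep 2) P P') < δ →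
          |Ft (coords P' - s) - Ft (coords P - s)| ≤ (Lf / (1 - 2 * r) + η) * Real.sqrt (torusRiemannDistSq (fundamentalLatticeRep 2) P P') :=
      ext_shift_uniformLocalLipschitz F hLf hlip hr hη
    refine ⟨δ / 2, half_pos hδ, fun P P' h1 h2 => ?_⟩
    have hPP' : Real.sqrt (torusRiemannDistSq (fundamentalLatticeRep 2) P P') < δ := by
      have htri := sqrt_torusRiemannDistSq_two_triangle P Q₀ P'
      rw [torusRiemannDistSq_two_comm P Q₀] at htri
      linarith
    exact normed_convolution_sub_le volume φ hFt (coords P') (coords P)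
      (B := (Lf / (1 - 2 * r) + η) * Real.sqrt (torusRiemannDistSq (fundamentalLatticeRep 2) P P'))
      (fun s hs => hloc s (mem_ball_zero_iff.1 hs).le P P' hPP')
  exact ⟨g, hg, happrox, hglip⟩

/-! ## §2. The Poincaré inequality for every `ρ_L`-Lipschitz observable -/

/-- ★★★ **Volume-uniform Poincaré inequality for EVERY `ρ_L`-Lipschitz observable**: at `|β'| < 1/12`, for every `L` and every `F : SU(2)^E → ℝ` with
`|F(Q') − F(Q)| ≤ L_F·ρ_L(Q,Q')`:  `∫ (F − ∫F dμ_(β'))² dμ_(β') ≤ L_F²/(1 − 12|β'|)` — Shen–Zhu–Zhu's (4.11) with the intrinsic Lipschitz constant, no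
smoothness assumed. [cite: ShenZhuZhu2022, Corollary 4.4 (4.11)] -/
theorem wilson_variance_le_of_riemannLipschitz_all (L : ℕ) [NeZero L] (β' : ℝ) (hβ : |β'| < 1 / 12)
    {F : GaugeConfig 3 L (Matrix.specialUnitaryGroup (Fin 2) ℂ) → ℝ} {Lf : ℝ} (hLf : 0 ≤ Lf)
    (hlip : ∀ Q Q', |F Q' - F Q| ≤ Lf * Real.sqrt (torusRiemannDistSq (fundamentalLatticeRep 2) Q Q')) :
    ∫ V, (F V - ∫ V', F V' ∂(wilsonMeasure (d := 3) (L := L) (fundamentalRep (Fin 2)) β')) ^ 2 ∂(wilsonMeasure (d := 3) (L := L) (fundamentalRep (Fin 2)) β') ≤ Lf ^ 2 / (1 - 12 * |β'|) := by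
  let coords : GaugeConfig 3 L (Matrix.specialUnitaryGroup (Fin 2) ℂ) → (Edge 3 L × Fin 2 × Fin 2 × Bool → ℝ) :=
    fun V q => (fun z : ℂ => if q.2.2.2 then z.im else z.re) ((fundamentalRep (Fin 2) (V q.1) : Matrix (Fin 2) (Fin 2) ℂ) q.2.1 q.2.2.1)
  haveI : IsProbabilityMeasure (wilsonMeasure (d := 3) (L := L) (fundamentalRep (Fin 2)) β') :=
    isProbabilityMeasure_wilsonMeasure (d := 3) (L := L) (fundamentalRep (Fin 2)) (continuous_fundamentalRep (Fin 2)) β'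
  haveI := borelSpace_config L
  set c : ℝ := 1 - 12 * |β'| with hcdef
  have hc : 0 < c := by rw [hcdef]; linarith
  set E : ℝ := Real.sqrt (Fintype.card (Edge 3 L)) with hEdef
  have hco : Continuous coords := continuous_coords (L := L)
  have hFc : Continuous F := continuous_of_riemannLipschitz hlip
  have hFi : Integrable F (wilsonMeasure (d := 3) (L := L) (fundamentalRep (Fin 2)) β') := hFc.integrable_of_hasCompactSupport (HasCompactSupport.of_compactSpace F)
  obtain ⟨mF, hmF⟩ : ∃ m : ℝ, m = ∫ V', F V' ∂(wilsonMeasure (d := 3) (L := L) (fundamentalRep (Fin 2)) β') := ⟨_, rfl⟩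
  rw [← hmF]
  -- Step 1: comparison with the approximant, for every `η > 0` and `0 < r ≤ 1/4`
  have hstep : ∀ η : ℝ, 0 < η → ∀ r : ℝ, 0 < r → r ≤ 1 / 4 →
      ∫ V, (F V - mF) ^ 2 ∂(wilsonMeasure (d := 3) (L := L) (fundamentalRep (Fin 2)) β') ≤ (1 + η) * ((Lf / (1 - 2 * r)) ^ 2 / c) + (1 + 1 / η) * (2 * (Lf * (12 * E * r))) ^ 2 := by
    intro η hη r hr0 hr
    have h12 : 0 < 1 - 2 * r := by linarith
    obtain ⟨g, hg, happrox', hglip⟩ := exists_smooth_riemannLipschitz_approx L hLf hlip hr0 hr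
    have happrox : ∀ P, |g (coords P) - F P| ≤ Lf * (12 * E * r) := happrox'
    obtain ⟨ε, hεdef⟩ : ∃ e : ℝ, e = Lf * (12 * E * r) := ⟨_, rfl⟩
    rw [← hεdef] at happrox ⊢
    have hGc : Continuous fun V => g (coords V) := hg.continuous.comp hco
    have hGi : Integrable (fun V => g (coords V)) (wilsonMeasure (d := 3) (L := L) (fundamentalRep (Fin 2)) β') := hGc.integrable_of_hasCompactSupport (HasCompactSupport.of_compactSpace _)
    obtain ⟨mG, hmG⟩ : ∃ m : ℝ, m = ∫ V', g (coords V') ∂(wilsonMeasure (d := 3) (L := L) (fundamentalRep (Fin 2)) β') := ⟨_, rfl⟩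
    have hvarG : ∫ V, (g (coords V) - mG) ^ 2 ∂(wilsonMeasure (d := 3) (L := L) (fundamentalRep (Fin 2)) β') ≤ (Lf / (1 - 2 * r)) ^ 2 / c := by
      rw [hmG]
      exact wilson_variance_le_of_riemannLipschitz_uniform L β' hβ g (hg.of_le (by norm_num)) (div_nonneg hLf h12.le) hglip
    have hmean : |mF - mG| ≤ ε := by
      rw [hmF, hmG, ← integral_sub hFi hGi]
      calc |∫ V, (F V - g (coords V)) ∂(wilsonMeasure (d := 3) (L := L) (fundamentalRep (Fin 2)) β')| ≤ ∫ V, |F V - g (coords V)| ∂(wilsonMeasure (d := 3) (L := L) (fundamentalRep (Fin 2)) β') := abs_integral_le_integral_abs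
        _ ≤ ∫ _V, ε ∂(wilsonMeasure (d := 3) (L := L) (fundamentalRep (Fin 2)) β') :=
            integral_mono_of_nonneg (ae_of_all _ fun _ => abs_nonneg _) (integrable_const _)
              (ae_of_all _ fun V => (abs_sub_comm _ _).trans_le (happrox V))
        _ = ε := by rw [integral_const, probReal_univ, one_smul]
    have young : ∀ b d : ℝ, (b + d) ^ 2 ≤ (1 + η) * b ^ 2 + (1 + 1 / η) * d ^ 2 := by
      intro b d
      have hkey : (1 + η) * b ^ 2 + (1 + 1 / η) * d ^ 2 - (b + d) ^ 2 = (η * b - d) ^ 2 / η := by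
        field_simp
        ring
      have hnn : 0 ≤ (η * b - d) ^ 2 / η := div_nonneg (sq_nonneg _) hη.le
      linarith
    have hpt : ∀ V, (F V - mF) ^ 2 ≤ (1 + η) * (g (coords V) - mG) ^ 2 + (1 + 1 / η) * (2 * ε) ^ 2 := by
      intro V
      have hdabs : |(F V - mF) - (g (coords V) - mG)| ≤ 2 * ε := by
        have h1 : |F V - g (coords V)| ≤ ε := (abs_sub_comm _ _).trans_le (happrox V)
        have h2 : (F V - mF) - (g (coords V) - mG) = (F V - g (coords V)) - (mF - mG) := by ring
        rw [h2]
        exact (abs_sub _ _).trans (by linarith [hmean])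
      have hd2 : ((F V - mF) - (g (coords V) - mG)) ^ 2 ≤ (2 * ε) ^ 2 := by
        rw [← sq_abs ((F V - mF) - (g (coords V) - mG))]
        exact pow_le_pow_left₀ (abs_nonneg _) hdabs 2
      have hy := young (g (coords V) - mG) ((F V - mF) - (g (coords V) - mG))
      have heq : g (coords V) - mG + (F V - mF - (g (coords V) - mG)) = F V - mF := by ring
      rw [heq] at hy
      have hη' : 0 ≤ 1 + 1 / η := by positivity
      nlinarith [mul_le_mul_of_nonneg_left hd2 hη']
    have hFi2 : Integrable (fun V => (F V - mF) ^ 2) (wilsonMeasure (d := 3) (L := L) (fundamentalRep (Fin 2)) β') :=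
      ((hFc.sub continuous_const).pow 2).integrable_of_hasCompactSupport (HasCompactSupport.of_compactSpace _)
    have hGi2 : Integrable (fun V => (g (coords V) - mG) ^ 2) (wilsonMeasure (d := 3) (L := L) (fundamentalRep (Fin 2)) β') :=
      ((hGc.sub continuous_const).pow 2).integrable_of_hasCompactSupport (HasCompactSupport.of_compactSpace _)
    have hsumi : Integrable (fun V => (1 + η) * (g (coords V) - mG) ^ 2 + (1 + 1 / η) * (2 * ε) ^ 2) (wilsonMeasure (d := 3) (L := L) (fundamentalRep (Fin 2)) β') :=
      (hGi2.const_mul (1 + η)).add (integrable_const _)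
    calc ∫ V, (F V - mF) ^ 2 ∂(wilsonMeasure (d := 3) (L := L) (fundamentalRep (Fin 2)) β') ≤ ∫ V, ((1 + η) * (g (coords V) - mG) ^ 2 + (1 + 1 / η) * (2 * ε) ^ 2) ∂(wilsonMeasure (d := 3) (L := L) (fundamentalRep (Fin 2)) β') :=
          integral_mono hFi2 hsumi fun V => hpt V
      _ = (1 + η) * ∫ V, (g (coords V) - mG) ^ 2 ∂(wilsonMeasure (d := 3) (L := L) (fundamentalRep (Fin 2)) β') + (1 + 1 / η) * (2 * ε) ^ 2 := by
          rw [integral_add (hGi2.const_mul _) (integrable_const _), integral_const_mul, integral_const, probReal_univ, one_smul]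
      _ ≤ (1 + η) * ((Lf / (1 - 2 * r)) ^ 2 / c) + (1 + 1 / η) * (2 * ε) ^ 2 := by
          gcongr
  -- Step 2: `r → 0` at fixed `η`
  have hstep2 : ∀ η : ℝ, 0 < η → ∫ V, (F V - mF) ^ 2 ∂(wilsonMeasure (d := 3) (L := L) (fundamentalRep (Fin 2)) β') ≤ (1 + η) * (Lf ^ 2 / c) := by
    intro η hη
    have h1 : ContinuousAt (fun r : ℝ => 1 - 2 * r) 0 := (continuous_const.sub (continuous_const.mul continuous_id)).continuousAt
    have h2 : ContinuousAt (fun r : ℝ => Lf / (1 - 2 * r)) 0 := continuousAt_const.div h1 (by norm_num)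
    have hcont : ContinuousAt (fun r : ℝ => (1 + η) * ((Lf / (1 - 2 * r)) ^ 2 / c) + (1 + 1 / η) * (2 * (Lf * (12 * E * r))) ^ 2) 0 :=
      (((h2.pow 2).div_const c).const_mul (1 + η)).add
        ((continuous_const.mul ((continuous_const.mul (continuous_const.mul (continuous_const.mul continuous_id))).pow 2)).continuousAt)
    have hlim := tendsto_nhdsWithin_of_tendsto_nhds (s := Set.Ioi (0 : ℝ)) hcont.tendsto
    have hval : (1 + η) * ((Lf / (1 - 2 * (0 : ℝ))) ^ 2 / c) + (1 + 1 / η) * (2 * (Lf * (12 * E * 0))) ^ 2 = (1 + η) * (Lf ^ 2 / c) := by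
      simp
    rw [hval] at hlim
    refine ge_of_tendsto hlim ?_
    have hev : ∀ᶠ r in 𝓝[Set.Ioi (0 : ℝ)] 0, r < 1 / 4 := (eventually_lt_nhds (by norm_num : (0 : ℝ) < 1 / 4)).filter_mono nhdsWithin_le_nhds
    filter_upwards [self_mem_nhdsWithin, hev] with r hr0 hr4
    exact hstep η hη r hr0 hr4.le
  -- Step 3: `η → 0`
  have hcont' : Tendsto (fun η : ℝ => (1 + η) * (Lf ^ 2 / c)) (𝓝[Set.Ioi (0 : ℝ)] 0) (𝓝 ((1 + 0) * (Lf ^ 2 / c))) :=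
    tendsto_nhdsWithin_of_tendsto_nhds (((continuous_const.add continuous_id).mul continuous_const).tendsto 0)
  rw [add_zero, one_mul] at hcont'
  refine ge_of_tendsto hcont' ?_
  filter_upwards [self_mem_nhdsWithin] with η hη
  exact hstep2 η hη

/-! ## §3. Gaussian concentration for every `ρ_L`-Lipschitz observable -/

/-- ★★★ **Volume-uniform Gaussian concentration for EVERY `ρ_L`-Lipschitz observable**: at `|β'| < 1/12`, for every `L`, every `F : SU(2)^E → ℝ` with
`|F(Q') − F(Q)| ≤ L_F·ρ_L(Q,Q')` (`L_F > 0`) and every `s ≥ 0`:  `μ_(β'){V | ∫F dμ_(β') + s ≤ F(V)} ≤ exp(−(1 − 12|β'|)·s²/(2L_F²))` — Gaussian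
concentration of Lipschitz functions of Shen–Zhu–Zhu's Riemannian distance (log-Sobolev (4.12) + Herbst), no smoothness assumed, independent of the
volume. [cite: BakryGentilLedoux2014, Prop. 5.4.1] [cite: ShenZhuZhu2022, Corollary 4.4 (4.12)] -/
theorem wilson_concentration_riemannLipschitz_all (L : ℕ) [NeZero L] (β' : ℝ) (hβ : |β'| < 1 / 12)
    {F : GaugeConfig 3 L (Matrix.specialUnitaryGroup (Fin 2) ℂ) → ℝ} {Lf : ℝ} (hLf : 0 < Lf)
    (hlip : ∀ Q Q', |F Q' - F Q| ≤ Lf * Real.sqrt (torusRiemannDistSq (fundamentalLatticeRep 2) Q Q')) (s : ℝ) (hs : 0 ≤ s) :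
    (wilsonMeasure (d := 3) (L := L) (fundamentalRep (Fin 2)) β').real {V | (∫ V', F V' ∂(wilsonMeasure (d := 3) (L := L) (fundamentalRep (Fin 2)) β')) + s ≤ F V} ≤ Real.exp (-((1 - 12 * |β'|) * s ^ 2 / (2 * Lf ^ 2))) := by
  let coords : GaugeConfig 3 L (Matrix.specialUnitaryGroup (Fin 2) ℂ) → (Edge 3 L × Fin 2 × Fin 2 × Bool → ℝ) :=
    fun V q => (fun z : ℂ => if q.2.2.2 then z.im else z.re) ((fundamentalRep (Fin 2) (V q.1) : Matrix (Fin 2) (Fin 2) ℂ) q.2.1 q.2.2.1)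
  haveI : IsProbabilityMeasure (wilsonMeasure (d := 3) (L := L) (fundamentalRep (Fin 2)) β') :=
    isProbabilityMeasure_wilsonMeasure (d := 3) (L := L) (fundamentalRep (Fin 2)) (continuous_fundamentalRep (Fin 2)) β'
  haveI := borelSpace_config L
  set c : ℝ := 1 - 12 * |β'| with hcdef
  set E : ℝ := Real.sqrt (Fintype.card (Edge 3 L)) with hEdef
  have hco : Continuous coords := continuous_coords (L := L)
  have hFc : Continuous F := continuous_of_riemannLipschitz hlip
  have hFi : Integrable F (wilsonMeasure (d := 3) (L := L) (fundamentalRep (Fin 2)) β') := hFc.integrable_of_hasCompactSupport (HasCompactSupport.of_compactSpace F)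
  obtain ⟨mF, hmF⟩ : ∃ m : ℝ, m = ∫ V', F V' ∂(wilsonMeasure (d := 3) (L := L) (fundamentalRep (Fin 2)) β') := ⟨_, rfl⟩
  rw [← hmF]
  rcases hs.eq_or_lt with hs0 | hs0
  · -- `s = 0`: the bound is `1`
    rw [← hs0]
    simp only [ne_eq, OfNat.ofNat_ne_zero, not_false_eq_true, zero_pow, mul_zero, zero_div, neg_zero, Real.exp_zero]
    exact (measureReal_mono (Set.subset_univ _)).trans (by rw [probReal_univ])
  -- Step 1: comparison with the approximant
  have hstep : ∀ r : ℝ, 0 < r → r ≤ 1 / 4 → 2 * (Lf * (12 * E * r)) < s →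
      (wilsonMeasure (d := 3) (L := L) (fundamentalRep (Fin 2)) β').real {V | mF + s ≤ F V} ≤ Real.exp (-(c * (s - 2 * (Lf * (12 * E * r))) ^ 2 / (2 * (Lf / (1 - 2 * r)) ^ 2))) := by
    intro r hr0 hr hεs
    have h12 : 0 < 1 - 2 * r := by linarith
    obtain ⟨g, hg, happrox', hglip⟩ := exists_smooth_riemannLipschitz_approx L hLf.le hlip hr0 hr
    have happrox : ∀ P, |g (coords P) - F P| ≤ Lf * (12 * E * r) := happrox'
    obtain ⟨ε, hεdef⟩ : ∃ e : ℝ, e = Lf * (12 * E * r) := ⟨_, rfl⟩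
    rw [← hεdef] at happrox ⊢
    have hGc : Continuous fun V => g (coords V) := hg.continuous.comp hco
    have hGi : Integrable (fun V => g (coords V)) (wilsonMeasure (d := 3) (L := L) (fundamentalRep (Fin 2)) β') := hGc.integrable_of_hasCompactSupport (HasCompactSupport.of_compactSpace _)
    obtain ⟨mG, hmG⟩ : ∃ m : ℝ, m = ∫ V', g (coords V') ∂(wilsonMeasure (d := 3) (L := L) (fundamentalRep (Fin 2)) β') := ⟨_, rfl⟩
    have hmean : |mF - mG| ≤ ε := by
      rw [hmF, hmG, ← integral_sub hFi hGi]
      calc |∫ V, (F V - g (coords V)) ∂(wilsonMeasure (d := 3) (L := L) (fundamentalRep (Fin 2)) β')| ≤ ∫ V, |F V - g (coords V)| ∂(wilsonMeasure (d := 3) (L := L) (fundamentalRep (Fin 2)) β') := abs_integral_le_integral_abs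
        _ ≤ ∫ _V, ε ∂(wilsonMeasure (d := 3) (L := L) (fundamentalRep (Fin 2)) β') :=
            integral_mono_of_nonneg (ae_of_all _ fun _ => abs_nonneg _) (integrable_const _)
              (ae_of_all _ fun V => (abs_sub_comm _ _).trans_le (happrox V))
        _ = ε := by rw [integral_const, probReal_univ, one_smul]
    have hsub : {V | mF + s ≤ F V} ⊆ {V | mG + (s - 2 * ε) ≤ g (coords V)} := by
      intro V hV
      simp only [Set.mem_setOf_eq] at hV ⊢
      have h1 := (abs_le.1 (happrox V)).1
      have h2 := (abs_le.1 hmean).1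
      linarith
    have hconc : (wilsonMeasure (d := 3) (L := L) (fundamentalRep (Fin 2)) β').real {V | mG + (s - 2 * ε) ≤ g (coords V)} ≤ Real.exp (-(c * (s - 2 * ε) ^ 2 / (2 * (Lf / (1 - 2 * r)) ^ 2))) := by
      rw [hmG]
      exact wilson_concentration_riemannLipschitz_uniform L β' hβ g (hg.of_le (by norm_num)) (div_pos hLf h12) hglip (s - 2 * ε) (by linarith)
    exact (measureReal_mono hsub).trans hconc
  -- Step 2: `r → 0`
  have h1 : ContinuousAt (fun r : ℝ => 1 - 2 * r) 0 := (continuous_const.sub (continuous_const.mul continuous_id)).continuousAt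
  have h2 : ContinuousAt (fun r : ℝ => Lf / (1 - 2 * r)) 0 := continuousAt_const.div h1 (by norm_num)
  have hε : Continuous fun r : ℝ => 2 * (Lf * (12 * E * r)) := continuous_const.mul (continuous_const.mul (continuous_const.mul continuous_id))
  have hden : ContinuousAt (fun r : ℝ => 2 * (Lf / (1 - 2 * r)) ^ 2) 0 := (h2.pow 2).const_mul 2
  have hden0 : (2 * (Lf / (1 - 2 * (0 : ℝ))) ^ 2) ≠ 0 := by
    have : (0 : ℝ) < Lf ^ 2 := by positivity
    simp; positivity
  have hcont : ContinuousAt (fun r : ℝ => Real.exp (-(c * (s - 2 * (Lf * (12 * E * r))) ^ 2 / (2 * (Lf / (1 - 2 * r)) ^ 2)))) 0 :=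
    Real.continuous_exp.continuousAt.comp
      ((((continuous_const.sub hε).pow 2).continuousAt.const_mul c |>.div hden hden0).neg)
  have hlim := tendsto_nhdsWithin_of_tendsto_nhds (s := Set.Ioi (0 : ℝ)) hcont.tendsto
  have hval : Real.exp (-(c * (s - 2 * (Lf * (12 * E * 0))) ^ 2 / (2 * (Lf / (1 - 2 * (0 : ℝ))) ^ 2))) = Real.exp (-(c * s ^ 2 / (2 * Lf ^ 2))) := by
    simp
  rw [hval] at hlim
  refine ge_of_tendsto hlim ?_
  have hev1 : ∀ᶠ r in 𝓝[Set.Ioi (0 : ℝ)] 0, r < 1 / 4 := (eventually_lt_nhds (by norm_num : (0 : ℝ) < 1 / 4)).filter_mono nhdsWithin_le_nhds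
  have hev2 : ∀ᶠ r in 𝓝[Set.Ioi (0 : ℝ)] 0, 2 * (Lf * (12 * E * r)) < s := by
    have ht : Tendsto (fun r : ℝ => 2 * (Lf * (12 * E * r))) (𝓝 0) (𝓝 (2 * (Lf * (12 * E * 0)))) := hε.tendsto 0
    simp only [mul_zero] at ht
    exact (ht.eventually_lt_const hs0).filter_mono nhdsWithin_le_nhds
  filter_upwards [self_mem_nhdsWithin, hev1, hev2] with r hr0 hr4 hrs
  exact hstep r hr0 hr4.le hrs

end Summit.QuantumFields.YangMills.Theorems.ColdStartUniversality

end
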